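import Mathlib.Analysis.SpecialFunctions.Trigonometric.Basic
import Literature.Probability.Percolation.FKLoopNestingGaussianLimit
import HarnessLib

/-!
# The `cos_μ` nesting transform of a planar loop collection

Definition requested by the route `Summits/CriticalPhenomena/CardyFormulaZ2/Theses/CardyExpCovariance`
(engine child `CylinderNestingGaussian`, crux `PairIdentification`; companion of
`Literature.Probability.Percolation.CylinderLoops`): for a loop collection `L : LoopSpace ℂ`
(Aizenman–Burchard / Camia–Newman space of the prelude, `LoopEnsembleSpace`), a test function
`φ : ℂ → ℝ` and a twist `μ`,

`cosMuNestingTransform μ φ L = ∏_{ℓ ∈ L} cos(∫_{int ℓ} φ + 2πμ) / cos(2πμ) = ∏_{ℓ ∈ L} cos_μ(∫_{int ℓ} φ)`,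

the loop functional of the Baxter–Kelland–Wu identity and of Cor. 10 of Duminil-Copin–Kozlowski–
Lammers–Manolescu, arXiv:2603.06268, §3.2 (display before Cor. 10: `μ = arccos(√q/2)/2π`,
`cos_μ(x) = cos(x + 2πμ)/cos(2πμ)`, "`int(ℓ)` is the interior of the loop `ℓ`, i.e., the bounded
connected component of `ℝ² ∖ ℓ` when `ℓ` is viewed as a continuous simple path"), written for a loop
*collection* rather than for a bond configuration (the tree's `loopNestingWeight q φ δ ω` of
`FKLoopNestingGaussianLimit` is the same product for the planar lattice loops of `ω` and a signed
measure `φ`). At `q = 1` (critical percolation) `μ = 1/6` and `cos_μ(x) = 2cos(x + π/3)`.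

## Contents

* `LoopSpace.unbasedLoops L` — the members of `L` that are loops, modulo base point
  (`UnbasedLoop.mk ∘ BasedLoop.mk`; deliberate dot-notation extension of the prelude's `LoopSpace`).
  Lattice loop collections (`bondLoopCollection`, `cylinderLoopCollection`) contain every based
  representative of a geometric loop (one curve class per base dart); these coincide as unbased
  loops, so each geometric loop is counted once.
* `cosMuNestingTransform μ φ L` — the `finprod` over `L.unbasedLoops` of
  `cos(∫_{int u} φ + 2πμ)/cos(2πμ)`, `int u = loopInterior u = {z | W(u, z) ≠ 0}` the winding-number
  interior (`FKLoopNestingGaussianLimit`; the bounded complementary component for a simple loop) and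
  `∫` the Lebesgue (Bochner) integral; `cosMuNestingTransform_dklmMu` (factors `= cosMu q` at
  `μ = dklmMu q`), `cosMuNestingTransform_one_sixth` / `_dklmMu_one` (`μ = 1/6`: factors
  `2cos(· + π/3)`), `cosMuNestingTransform_bot` (empty collection: `1`).

## Design choices

* **`finprod` and its domain of honesty.** The product is Mathlib's `finprod`: the finite product
  over the loops with a factor `≠ 1` when there are finitely many, and the junk value `1` otherwise.
  For a lattice collection at positive mesh and a bounded test function `φ` with compact support and
  `∫ φ = 0` (supported in `ℂ ∖ {0}` on the cylinder), a loop whose trace misses a closed ball (resp.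
  annulus) `A ⊇ supp φ` has `supp φ ⊆ int u` or `supp φ ∩ int u = ∅`, hence `∫_{int u} φ ∈ {∫ φ, 0} = {0}`
  and factor `cos_μ(0) = 1`; distinct interface loops are dart-disjoint, so only the finitely many
  loops meeting `A` carry the product, which is then DKLM's honest finite product. This is the second
  role of the mass-zero condition of DKLM's test functions (Def. 5). Without it, or for a continuum
  ensemble (CLE, where infinitely many small loops carry `φ`-mass), the `finprod` is junk: the nesting
  transform of a scaling limit is a limit of lattice expectations (or a renormalised nesting field),
  not this functional of the limiting collection, and consumers state it as such.
* `μ` is a free real parameter as requested (`μ = dklmMu q` recovers DKLM's `cos_μ = cosMu q`); for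
  `cos(2πμ) = 0` every factor is the junk `x/0 = 0`.
* Test functions are functions `φ : ℂ → ℝ` integrated against Lebesgue measure on `int u` (the
  consumer routes' convention, cf. `CardyMagicRigidity.MagicFormulaZ2`); DKLM's generalised test
  functions (signed measures) are served by `loopNestingWeight`.

## References

* H. Duminil-Copin, K. K. Kozlowski, P. Lammers, I. Manolescu, arXiv:2603.06268 (2026), §3.2
  (display before Cor. 10), Def. 5, Cor. 10 (p. 13).
* H. Duminil-Copin, K. K. Kozlowski, D. Krachun, I. Manolescu, M. Oulamara, arXiv:2012.11672v2, §1.2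
  (loops taken unbased).
* F. Camia, C. M. Newman, Comm. Math. Phys. 268 (2006), §2 (space of loop collections).
-/

noncomputable section

open MeasureTheory Set
open scoped Real

namespace Literature.Probability.Percolation

open LatticeModels RandomPlanarGeometry

/-! ### Unbased loops of a collection -/

/-- The **unbased loops of a loop collection**: the classes, modulo change of base point
(`UnbasedLoop.mk ∘ BasedLoop.mk`), of the members of `L` that are loops (non-closed members, absent
from genuine loop collections, are discarded). All based representatives of one oriented loop have the
same image. Deliberate dot-notation extension of the prelude's `LoopSpace`
(`Literature.Probability.RandomPlanarGeometry.LoopEnsembleSpace`). [cite: arXiv201211672v2, §1.2] -/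
def _root_.Literature.Probability.RandomPlanarGeometry.LoopSpace.unbasedLoops {E : Type*} [MetricSpace E]
    (L : LoopSpace E) : Set (UnbasedLoop E) :=
  {u | ∃ (c : CurveClass E) (h : c.IsLoop), c ∈ L ∧ u = UnbasedLoop.mk (BasedLoop.mk c h)}

/-- Membership in `LoopSpace.unbasedLoops`. [folklore] -/
theorem _root_.Literature.Probability.RandomPlanarGeometry.LoopSpace.mem_unbasedLoops_iff {E : Type*}
    [MetricSpace E] {L : LoopSpace E} {u : UnbasedLoop E} :
    u ∈ L.unbasedLoops ↔ ∃ (c : CurveClass E) (h : c.IsLoop), c ∈ L ∧ u = UnbasedLoop.mk (BasedLoop.mk c h) :=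
  Iff.rfl

/-- `unbasedLoops` is monotone in the collection. [folklore] -/
theorem _root_.Literature.Probability.RandomPlanarGeometry.LoopSpace.unbasedLoops_mono {E : Type*} [MetricSpace E]
    {L L' : LoopSpace E} (h : L ≤ L') : L.unbasedLoops ⊆ L'.unbasedLoops := by
  rintro u ⟨c, hc, hcL, rfl⟩
  exact ⟨c, hc, h hcL, rfl⟩

/-! ### The transform -/

/-- **The `cos_μ` nesting transform** of the loop collection `L` against the test function
`φ : ℂ → ℝ` with twist `μ`:
`∏_{ℓ ∈ L} cos(∫_{int ℓ} φ + 2πμ) / cos(2πμ) = ∏_{ℓ ∈ L} cos_μ(∫_{int ℓ} φ)`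
(DKLM §3.2, display before Cor. 10, with `cos_μ(x) = cos(x + 2πμ)/cos(2πμ)` = `cosMu q x` at
`μ = dklmMu q = arccos(√q/2)/2π`; `μ = 1/6`, `cos_μ(x) = 2cos(x + π/3)` for percolation, `q = 1`).
Here the product runs over the unbased loops of `L` (`LoopSpace.unbasedLoops`, so that the several
based representatives of a lattice loop count once), `int ℓ = loopInterior ℓ = {z | W(ℓ, z) ≠ 0}` is
the winding-number interior (the bounded complementary component for a simple loop; DKLM: "the
bounded connected component of `ℝ² ∖ ℓ` when `ℓ` is viewed as a continuous simple path") and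
`∫_{int ℓ} φ` is the Lebesgue (Bochner) integral. The product is a `finprod`: the honest finite
product when only finitely many loops have a factor `≠ 1` — the case of the lattice collections
`bondLoopCollection`, `cylinderLoopCollection` against a compactly supported `φ` of total integral
`0` (supported in `ℂ ∖ {0}` on the cylinder), for which every loop missing a closed ball (closed
annulus on the cylinder) containing the support has `∫_{int ℓ} φ ∈ {0, ∫ φ} = {0}` — and the junk
value `1` otherwise; in
particular it is NOT the renormalised nesting field of a continuum loop ensemble (infinitely many
small loops carry `φ`-mass there), which has to be defined by a limiting procedure.
[cite: DuminilCopinKozlowskiLammersManolescu2026, §3.2] -/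
def cosMuNestingTransform (μ : ℝ) (φ : ℂ → ℝ) (L : LoopSpace ℂ) : ℝ :=
  ∏ᶠ u ∈ L.unbasedLoops, Real.cos ((∫ z in loopInterior u, φ z) + 2 * π * μ) / Real.cos (2 * π * μ)

/-- `cosMuNestingTransform` with the interior written out as `{z | W(u, z) ≠ 0}` (the form used by the
consumer routes). [cite: DuminilCopinKozlowskiLammersManolescu2026, §3.2] -/
theorem cosMuNestingTransform_eq (μ : ℝ) (φ : ℂ → ℝ) (L : LoopSpace ℂ) :
    cosMuNestingTransform μ φ L =
      ∏ᶠ u ∈ L.unbasedLoops, Real.cos ((∫ z in {z | u.wind z ≠ 0}, φ z) + 2 * π * μ) / Real.cos (2 * π * μ) :=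
  rfl

/-- At DKLM's twist `μ = μ(q) = arccos(√q/2)/2π` the factors are DKLM's `cos_μ` weights `cosMu q`.
[cite: DuminilCopinKozlowskiLammersManolescu2026, §3.2] -/
theorem cosMuNestingTransform_dklmMu (q : ℝ) (φ : ℂ → ℝ) (L : LoopSpace ℂ) :
    cosMuNestingTransform (dklmMu q) φ L = ∏ᶠ u ∈ L.unbasedLoops, cosMu q (∫ z in loopInterior u, φ z) :=
  rfl

/-- **The percolation case `μ = 1/6`**: `cos(x + π/3)/cos(π/3) = 2 cos(x + π/3)`, so the transform is
`∏_ℓ 2cos(∫_{int ℓ} φ + π/3)`. [cite: DuminilCopinKozlowskiLammersManolescu2026, §3.2] -/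
theorem cosMuNestingTransform_one_sixth (φ : ℂ → ℝ) (L : LoopSpace ℂ) :
    cosMuNestingTransform (1 / 6) φ L =
      ∏ᶠ u ∈ L.unbasedLoops, 2 * Real.cos ((∫ z in loopInterior u, φ z) + π / 3) := by
  rw [cosMuNestingTransform]
  refine finprod_mem_congr rfl fun u _ ↦ ?_
  rw [show 2 * π * (1 / 6 : ℝ) = π / 3 by ring, Real.cos_pi_div_three, div_div_eq_mul_div, div_one,
    mul_comm]

/-- `μ(1) = 1/6`: the percolation transform is `cosMuNestingTransform (dklmMu 1)`.
[cite: DuminilCopinKozlowskiLammersManolescu2026, §3.2] -/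
theorem cosMuNestingTransform_dklmMu_one (φ : ℂ → ℝ) (L : LoopSpace ℂ) :
    cosMuNestingTransform (dklmMu 1) φ L =
      ∏ᶠ u ∈ L.unbasedLoops, 2 * Real.cos ((∫ z in loopInterior u, φ z) + π / 3) := by
  rw [dklmMu_one, cosMuNestingTransform_one_sixth]

/-- The empty collection has no unbased loops. [folklore] -/
theorem _root_.Literature.Probability.RandomPlanarGeometry.LoopSpace.unbasedLoops_bot {E : Type*} [MetricSpace E] :
    (⊥ : LoopSpace E).unbasedLoops = ∅ := by
  ext u
  simp only [LoopSpace.mem_unbasedLoops_iff, Set.mem_empty_iff_false, iff_false]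
  rintro ⟨c, -, hc, -⟩
  have hc' : c ∈ ((⊥ : LoopSpace E) : Set (CurveClass E)) := hc
  rw [TopologicalSpace.Closeds.coe_bot] at hc'
  exact hc'

/-- The transform of the empty collection is the empty product `1`. [folklore] -/
theorem cosMuNestingTransform_bot (μ : ℝ) (φ : ℂ → ℝ) : cosMuNestingTransform μ φ ⊥ = 1 := by
  rw [cosMuNestingTransform, LoopSpace.unbasedLoops_bot, finprod_mem_empty]

end Literature.Probability.Percolation

end
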